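import Mathlib
import HarnessLib

/-!
# The local Riemann hypothesis: the strip lemma and the shift operators `S(a,b,c)`

Companion to `LocalRiemannHypothesis.lean` (the Jacobi/Hermitian-matrix argument). This file
kernel-checks the OTHER classical mechanism behind "local Riemann hypotheses" for polynomials:
the *strip lemma* of Bump–Choi–Kurlberg–Vaaler, which is the second proof of
[cite: BumpEtAl2000, Thm 1] and goes back to Pólya's proof that the zeros of `ν ↦ K_ν(y)` are
purely imaginary (the recurrence `2νK_ν = x(K_{ν+1} − K_{ν−1})` "moves the zeros of a function
closer to the imaginary axis, and so an eigenfunction of this operator should have its zeros on the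
imaginary axis" [cite: BumpEtAl2000, §1, remark after the Lemma]).

**The Lemma** [cite: BumpEtAl2000, §1, Lemma in the second proof of Thm. 1], verbatim: *Let `q(s)`
be a polynomial, and assume that the zeros of `q(s)` lie in the closed strip `{Re(s) ∈ [−c, c]}`
with `c > 0`. Then if `a > 0`, the zeros of `r(s) = (s+a)q(s+2) − (s−a)q(s−2)` lie in the open
strip `{Re(s) ∈ (−c, c)}`.* The printed proof: if `Re s ≥ c` and `r(s) = 0` then
`|s+a|·∏|s+2−rᵢ| = |s−a|·∏|s−2−rᵢ|`, but `|s+a| > |s−a|` and `|s+2−rᵢ| > |s−2−rᵢ|` — contradiction;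
`Re s ≤ −c` symmetrically. "The theorem now follows": the Hermite–Mellin polynomial
`q(s) = p_n(s+1/2)` satisfies `λq = r` with `a = 1/2` or `3/2` (Mellin image of the Schrödinger
equation), and an eigenfunction of `q ↦ r` cannot have a zero of maximal `|Re| = c > 0`.

Olofsson [cite: Olofsson2009, Lemma 4.6, Remark 4.7] records the same lemma with an arbitrary shift
`b > 0` in place of `2` and uses it (proof of [cite: Olofsson2009, Thm. 1.1]) for the local Riemann
hypothesis at the complex place with `H = SU(2)`: there `(m+1)q = (s + (k+1)/2)q(s+1) − (s − (k+1)/2)q(s−1)`.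
Redmond [cite: Redmond2002, eigenfunction observation] put the operators in a family
`S(a,b,c) : q(X) ↦ (X+a)q(cX+b) − (X−a)q(cX−b)` and observed (statement as reported in the signed
zbMATH review Zbl 1014.11051): *any polynomial eigenfunction of a finite product `∏ S(aᵢ,bᵢ,cᵢ)`
(`aᵢ,bᵢ,cᵢ > 0`, `∏ cᵢ ≥ 1`) must have all its zeros on the imaginary axis.* Hindmarsh–Lettington
[cite: HindmarshLettington2022, Thm. 1.1/1.2] prove that `Q(z) = (m−z)P(z+b) + (m+z)P(z−b)`
(`b = 1` resp. `1/2`) has all its zeros on the imaginary axis whenever `P` (degree `ℓ`) does, in the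
cases `m ≤ 0` or `m ≥ ℓ` (resp. `m ≥ ℓ + 1/2`); for `m ≤ 0` this is `Q = −S(−m,b,1)P`.

## What is proved here (all over `ℂ`, multiplicities via `Polynomial.roots`)

* `redmondOp a b c q` — the operator `S(a,b,c)` over any commutative ring, `eval_redmondOp`.
* `norm_eval_sub_le_norm_eval_add` / `norm_eval_sub_lt_norm_eval_add` — the product inequality
  `‖q(w−b)‖ ≤ ‖q(w+b)‖` when `b·(Re w − Re ρ) ≥ 0` for every root `ρ` (strict when `> 0` and `q`
  has a root): the heart of the printed proof.
* `redmondOp_eval_eq_zero_re` — the strip lemma with a scale `c > 0` and a bookkeeping factor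
  `D > 0`: if `D·|Re ρ| ≤ K` for all roots of `q ≠ 0` then every zero `s` of `S(a,b,c)q` has
  `Re s = 0` or `D·c·|Re s| < K`. Specialisations AS PRINTED: `bckv_stripLemma` (`b = 2`, `c = 1`),
  `olofsson_lemma_4_6` (`b > 0`, `c = 1`).
* `redmondOp_ne_zero` (`S(a,b,c)` kills no nonzero polynomial), `redmondOp_roots_re_eq_zero`
  (purely-imaginary zeros are preserved — the single-operator invariance).
* `redmond_eigenfunction_roots_re_eq_zero` — Redmond's observation for NONEMPTY finite products
  (`redmondProd`), and its one-operator cases `roots_re_eq_zero_of_redmondOp_eq_smul`,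
  `bckv_roots_re_eq_zero_of_eigen` (BCKV's "the theorem now follows"),
  `olofsson_roots_re_eq_zero_of_eigen` (Olofsson's three-term identity).
* `hlTransform`, `hindmarshLettington_roots_re_eq_zero_of_nonpos` — [cite: HindmarshLettington2022,
  Thm. 1.1/1.2] in the case `m ≤ 0` (any shift `b > 0`; `m = 0` needs the strict inequality).

## What is deliberately NOT here

The case `m ≥ ℓ` (resp. `m ≥ ℓ + 1/2`) of [cite: HindmarshLettington2022, Thm. 1.1/1.2] (an
argument-counting proof along the axis, not the modulus argument); Redmond's principal NEGATIVE
result (imaginary-axis polynomials that are eigenfunctions of no finite product) and the upper-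
triangularity/diagonal `λ_k = 2c^{k−1}(kb+ac)` bookkeeping; the identification of the concrete
Hermite / Laguerre / `SU(2)` Mellin polynomials as eigenfunctions (the Hermite zeros themselves are
in `LocalRiemannHypothesis.lean` by the Jacobi route). No named facts are introduced.
-/

noncomputable section

namespace Literature.NumberTheory.LFunctions

open Polynomial

namespace LocalRH

section Operator

variable {R : Type*} [CommRing R]

/-- Redmond's shift operator `S(a,b,c) : q(X) ↦ (X+a)·q(cX+b) − (X−a)·q(cX−b)`
[cite: Redmond2002, definition of S(a,b,c)]; `S(a,2,1)` is the operator `q ↦ r` of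
[cite: BumpEtAl2000, §1, Lemma in the second proof of Thm. 1]. -/
def redmondOp (a b c : R) (q : R[X]) : R[X] :=
  (X + C a) * q.comp (C c * X + C b) - (X - C a) * q.comp (C c * X - C b)

/-- Pointwise formula `(S(a,b,c)q)(s) = (s+a)q(cs+b) − (s−a)q(cs−b)`.
[cite: Redmond2002, definition of S(a,b,c)] -/
theorem eval_redmondOp (a b c : R) (q : R[X]) (s : R) :
    (redmondOp a b c q).eval s = (s + a) * q.eval (c * s + b) - (s - a) * q.eval (c * s - b) := by
  simp [redmondOp, eval_comp]

/-- `S(a,b,c)` is additive. [cite: Redmond2002, definition of S(a,b,c)] -/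
theorem redmondOp_add (a b c : R) (p q : R[X]) :
    redmondOp a b c (p + q) = redmondOp a b c p + redmondOp a b c q := by
  simp only [redmondOp, add_comp]; ring

/-- `S(a,b,c)` commutes with scalars. [cite: Redmond2002, definition of S(a,b,c)] -/
theorem redmondOp_smul (a b c k : R) (q : R[X]) :
    redmondOp a b c (k • q) = k • redmondOp a b c q := by
  simp only [redmondOp, smul_eq_C_mul, mul_comp, C_comp]; ring

/-- `S(a,b,c) 0 = 0`. [cite: Redmond2002, definition of S(a,b,c)] -/
@[simp] theorem redmondOp_zero (a b c : R) : redmondOp a b c (0 : R[X]) = 0 := by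
  simp [redmondOp]

/-- On constants: `S(a,b,c)(k) = 2ak` (the diagonal entry `λ₀ = 2a`).
[cite: Redmond2002, definition of S(a,b,c)] -/
theorem redmondOp_C (a b c k : R) : redmondOp a b c (C k) = C (2 * a * k) := by
  simp only [redmondOp, C_comp, map_mul, map_ofNat]; ring

/-- Iterated operators: `redmondProd [p₁, …, pₘ] q = S(pₘ) ⋯ S(p₂) (S(p₁) q)` (the head of the list
acts first), a finite product `∏ S(aᵢ,bᵢ,cᵢ)` in the sense of [cite: Redmond2002, eigenfunction
observation]; parameters are real triples `(a, b, c)`. -/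
def redmondProd : List (ℝ × ℝ × ℝ) → ℂ[X] → ℂ[X]
  | [], q => q
  | p :: l, q => redmondProd l (redmondOp (p.1 : ℂ) (p.2.1 : ℂ) (p.2.2 : ℂ) q)

/-- `redmondProd [] q = q`. [cite: Redmond2002, eigenfunction observation] -/
@[simp] theorem redmondProd_nil (q : ℂ[X]) : redmondProd [] q = q := rfl

/-- `redmondProd (p :: l) q = redmondProd l (S(p) q)`. [cite: Redmond2002, eigenfunction observation] -/
@[simp] theorem redmondProd_cons (p : ℝ × ℝ × ℝ) (l : List (ℝ × ℝ × ℝ)) (q : ℂ[X]) :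
    redmondProd (p :: l) q = redmondProd l (redmondOp (p.1 : ℂ) (p.2.1 : ℂ) (p.2.2 : ℂ) q) := rfl

/-- The Hindmarsh–Lettington transformation `P ↦ Q`, `Q(z) = (m−z)P(z+b) + (m+z)P(z−b)`
(`b = 1`: `Q₁` of Thm. 1.1; `b = 1/2`: `Q₂` of Thm. 1.2). [cite: HindmarshLettington2022, Thm. 1.1/1.2] -/
def hlTransform (m b : R) (P : R[X]) : R[X] :=
  (C m - X) * P.comp (X + C b) + (C m + X) * P.comp (X - C b)

/-- Pointwise formula `Q(z) = (m−z)P(z+b) + (m+z)P(z−b)`. [cite: HindmarshLettington2022, Thm. 1.1/1.2] -/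
theorem eval_hlTransform (m b : R) (P : R[X]) (z : R) :
    (hlTransform m b P).eval z = (m - z) * P.eval (z + b) + (m + z) * P.eval (z - b) := by
  simp [hlTransform, eval_comp]

/-- `Q = −S(−m, b, 1) P`: the Hindmarsh–Lettington transformation is a Redmond operator with
`a = −m`. [cite: HindmarshLettington2022, Thm. 1.1/1.2] [cite: Redmond2002, definition of S(a,b,c)] -/
theorem hlTransform_eq_neg_redmondOp (m b : R) (P : R[X]) :
    hlTransform m b P = -redmondOp (-m) b 1 P := by
  simp only [hlTransform, redmondOp, map_neg, C_1, one_mul]; ring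

end Operator

section Norms

/-- For `z ∈ ℂ` and real `t` with `t·Re z ≥ 0`: `‖z − t‖ ≤ ‖z + t‖` (indeed
`‖z+t‖² − ‖z−t‖² = 4t·Re z`). [folklore] -/
private theorem norm_sub_ofReal_le_norm_add (z : ℂ) {t : ℝ} (h : 0 ≤ t * z.re) :
    ‖z - t‖ ≤ ‖z + t‖ := by
  rw [← sq_le_sq₀ (norm_nonneg _) (norm_nonneg _), Complex.sq_norm, Complex.sq_norm,
    Complex.normSq_apply, Complex.normSq_apply]
  simp only [Complex.sub_re, Complex.add_re, Complex.ofReal_re, Complex.sub_im, Complex.add_im,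
    Complex.ofReal_im]
  nlinarith

/-- For `z ∈ ℂ` and real `t` with `t·Re z > 0`: `‖z − t‖ < ‖z + t‖` — e.g. `|s+a| > |s−a|` for
`a > 0`, `Re s > 0` [cite: BumpEtAl2000, §1, proof of the Lemma]. -/
theorem norm_sub_ofReal_lt_norm_add (z : ℂ) {t : ℝ} (h : 0 < t * z.re) :
    ‖z - t‖ < ‖z + t‖ := by
  rw [← sq_lt_sq₀ (norm_nonneg _) (norm_nonneg _), Complex.sq_norm, Complex.sq_norm,
    Complex.normSq_apply, Complex.normSq_apply]
  simp only [Complex.sub_re, Complex.add_re, Complex.ofReal_re, Complex.sub_im, Complex.add_im,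
    Complex.ofReal_im]
  nlinarith

/-- `‖q(x)‖ = ‖lead q‖ · ∏_ρ ‖x − ρ‖` over the complex roots of `q` counted with multiplicity
(the factorisation `q(s) = c∏(s − rᵢ)` used in [cite: BumpEtAl2000, §1, proof of the Lemma]). -/
theorem norm_eval_eq_prod_roots (q : ℂ[X]) (x : ℂ) :
    ‖q.eval x‖ = ‖q.leadingCoeff‖ * (q.roots.map fun ρ => ‖x - ρ‖).prod := by
  have h := map_multiset_prod (normHom : ℂ →*₀ ℝ) (q.roots.map (x - ·))
  simp only [normHom_apply, Multiset.map_map, Function.comp_def] at h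
  rw [(IsAlgClosed.splits q).eval_eq_prod_roots x, norm_mul, h]

/-- A strict comparison of products of nonnegative reals over a nonempty multiset. [folklore] -/
private theorem multiset_prod_map_lt_prod_map {ι : Type*} {s : Multiset ι} (hs : s ≠ 0) (f g : ι → ℝ)
    (h0 : ∀ i ∈ s, 0 ≤ f i) (h : ∀ i ∈ s, f i < g i) :
    (s.map f).prod < (s.map g).prod := by
  induction s using Multiset.induction_on with
  | empty => exact absurd rfl hs
  | cons a t ih =>
    simp only [Multiset.map_cons, Multiset.prod_cons]
    have ha0 : 0 ≤ f a := h0 a (Multiset.mem_cons_self a t)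
    have ha : f a < g a := h a (Multiset.mem_cons_self a t)
    have ht0 : 0 ≤ (t.map f).prod := Multiset.prod_nonneg fun x hx => by
      obtain ⟨i, hi, rfl⟩ := Multiset.mem_map.mp hx
      exact h0 i (Multiset.mem_cons_of_mem hi)
    by_cases ht : t = 0
    · subst ht; simpa using ha
    · exact mul_lt_mul'' ha (ih ht (fun i hi => h0 i (Multiset.mem_cons_of_mem hi))
        (fun i hi => h i (Multiset.mem_cons_of_mem hi))) ha0 ht0

/-- **The product inequality of the strip lemma.** If `b·(Re w − Re ρ) ≥ 0` for every root `ρ`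
of `q`, then `‖q(w − b)‖ ≤ ‖q(w + b)‖` (each factor satisfies `|w+b−ρ| ≥ |w−b−ρ|`).
[cite: BumpEtAl2000, §1, proof of the Lemma] -/
theorem norm_eval_sub_le_norm_eval_add (q : ℂ[X]) (w : ℂ) {b : ℝ}
    (h : ∀ ρ ∈ q.roots, 0 ≤ b * (w.re - ρ.re)) :
    ‖q.eval (w - b)‖ ≤ ‖q.eval (w + b)‖ := by
  rw [norm_eval_eq_prod_roots, norm_eval_eq_prod_roots]
  refine mul_le_mul_of_nonneg_left ?_ (norm_nonneg _)
  refine Multiset.prod_map_le_prod_map₀ _ _ (fun ρ _ => norm_nonneg _) (fun ρ hρ => ?_)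
  rw [show w - (b : ℂ) - ρ = (w - ρ) - b by ring, show w + (b : ℂ) - ρ = (w - ρ) + b by ring]
  exact norm_sub_ofReal_le_norm_add (w - ρ) (by simpa [Complex.sub_re] using h ρ hρ)

/-- Strict form: if `q` has at least one root and `b·(Re w − Re ρ) > 0` for every root `ρ`, then
`‖q(w − b)‖ < ‖q(w + b)‖`. [cite: BumpEtAl2000, §1, proof of the Lemma] -/
theorem norm_eval_sub_lt_norm_eval_add (q : ℂ[X]) (w : ℂ) {b : ℝ} (hne : q.roots ≠ 0)
    (h : ∀ ρ ∈ q.roots, 0 < b * (w.re - ρ.re)) :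
    ‖q.eval (w - b)‖ < ‖q.eval (w + b)‖ := by
  have hq : q ≠ 0 := by rintro rfl; simp at hne
  rw [norm_eval_eq_prod_roots, norm_eval_eq_prod_roots]
  refine mul_lt_mul_of_pos_left ?_ (norm_pos_iff.mpr (leadingCoeff_ne_zero.mpr hq))
  refine multiset_prod_map_lt_prod_map hne _ _ (fun ρ _ => norm_nonneg _) (fun ρ hρ => ?_)
  rw [show w - (b : ℂ) - ρ = (w - ρ) - b by ring, show w + (b : ℂ) - ρ = (w - ρ) + b by ring]
  exact norm_sub_ofReal_lt_norm_add (w - ρ) (by simpa [Complex.sub_re] using h ρ hρ)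

/-- A point whose real part differs from that of every root is not a root. [folklore] -/
private theorem eval_ne_zero_of_re_ne {q : ℂ[X]} (hq : q ≠ 0) {z : ℂ} (h : ∀ ρ ∈ q.roots, ρ.re ≠ z.re) :
    q.eval z ≠ 0 := fun hz => h z ((mem_roots hq).mpr (IsRoot.def.mpr hz)) rfl

/-- Bookkeeping: `u·U = v·V` with `‖v‖ < ‖u‖`, `‖V‖ ≤ ‖U‖`, `U ≠ 0` is impossible
("multiplying these inequalities together, we obtain a contradiction"
[cite: BumpEtAl2000, §1, proof of the Lemma]). -/
private theorem false_of_mul_eq_mul_of_norm_lt {u v U V : ℂ} (he : u * U = v * V) (h1 : ‖v‖ < ‖u‖)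
    (h2 : ‖V‖ ≤ ‖U‖) (hU : U ≠ 0) : False := by
  have hU' : 0 < ‖U‖ := norm_pos_iff.mpr hU
  have h3 := congrArg norm he
  rw [norm_mul, norm_mul] at h3
  have h4 : ‖v‖ * ‖V‖ ≤ ‖v‖ * ‖U‖ := mul_le_mul_of_nonneg_left h2 (norm_nonneg _)
  nlinarith

/-- One-sided core of the strip lemma: if every root `ρ` of `q ≠ 0` has `b·(Re w − Re ρ) ≥ 0` and
`Re ρ ≠ Re w + b`, and `a·Re s > 0`, then `(s+a)q(w+b) ≠ (s−a)q(w−b)`. (Real `a, b` of either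
sign: the case `Re s < 0` of the printed proof is the case `a, b < 0` here.)
[cite: BumpEtAl2000, §1, proof of the Lemma] -/
theorem redmondOp_core {q : ℂ[X]} (hq : q ≠ 0) {w s : ℂ} {a b : ℝ} (ha : 0 < a * s.re)
    (hb : ∀ ρ ∈ q.roots, 0 ≤ b * (w.re - ρ.re)) (hb' : ∀ ρ ∈ q.roots, ρ.re ≠ w.re + b)
    (he : (s + a) * q.eval (w + b) = (s - a) * q.eval (w - b)) : False :=
  false_of_mul_eq_mul_of_norm_lt he (norm_sub_ofReal_lt_norm_add s ha)
    (norm_eval_sub_le_norm_eval_add q w hb)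
    (eval_ne_zero_of_re_ne hq (by simpa using hb'))

end Norms

section StripLemma

/-- **The strip lemma with a scale** (general form behind [cite: BumpEtAl2000, §1, Lemma in the
second proof of Thm. 1], [cite: Olofsson2009, Lemma 4.6] and [cite: Redmond2002, eigenfunction
observation]): let `a, b > 0`, `D > 0`, real `c, K`, `q ≠ 0` with `D·|Re ρ| ≤ K` for every root
`ρ` of `q`. Then every zero `s` of `S(a,b,c)q` satisfies `Re s = 0` or `D·c·|Re s| < K` — for
`c > 0` the zeros move strictly toward the imaginary axis (by the factor `1/c`) unless they are
already on it (for `c ≤ 0` the conclusion is weaker but still true). -/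
theorem redmondOp_eval_eq_zero_re {a b c D K : ℝ} (ha : 0 < a) (hb : 0 < b)
    (hD : 0 < D) {q : ℂ[X]} (hq : q ≠ 0)
    (hroots : ∀ ρ ∈ q.roots, D * |ρ.re| ≤ K) {s : ℂ}
    (hs : (redmondOp (a : ℂ) (b : ℂ) (c : ℂ) q).eval s = 0) :
    s.re = 0 ∨ D * c * |s.re| < K := by
  by_contra hcon
  push Not at hcon
  obtain ⟨hs0, hK'⟩ := hcon
  rw [eval_redmondOp, sub_eq_zero] at hs
  set w : ℂ := (c : ℂ) * s with hw
  have hwre : w.re = c * s.re := by simp [hw]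
  rcases lt_or_gt_of_ne hs0 with hneg | hpos
  · -- `Re s < 0`: every root has `Re ρ ≥ c·Re s = Re w`; use the core with `−a, −b`.
    have habs : |s.re| = -s.re := abs_of_neg hneg
    have hρ : ∀ ρ ∈ q.roots, w.re ≤ ρ.re := by
      intro ρ hρ
      have h1 : D * (-|ρ.re|) ≤ D * ρ.re := mul_le_mul_of_nonneg_left (neg_abs_le _) hD.le
      have h2 := hroots ρ hρ
      rw [habs] at hK'
      have h3 : D * (c * s.re) ≤ D * ρ.re := by nlinarith
      rw [hwre]; exact le_of_mul_le_mul_left h3 hD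
    refine redmondOp_core hq (a := -a) (b := -b) (w := w) (s := s) (by nlinarith)
      (fun ρ hρ' => by nlinarith [hρ ρ hρ']) (fun ρ hρ' => by linarith [hρ ρ hρ']) ?_
    push_cast
    simpa [sub_eq_add_neg] using hs.symm
  · -- `Re s > 0`: every root has `Re ρ ≤ c·Re s = Re w`; use the core with `a, b`.
    have habs : |s.re| = s.re := abs_of_pos hpos
    have hρ : ∀ ρ ∈ q.roots, ρ.re ≤ w.re := by
      intro ρ hρ
      have h1 : D * ρ.re ≤ D * |ρ.re| := mul_le_mul_of_nonneg_left (le_abs_self _) hD.le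
      have h2 := hroots ρ hρ
      rw [habs] at hK'
      have h3 : D * ρ.re ≤ D * (c * s.re) := by nlinarith
      rw [hwre]; exact le_of_mul_le_mul_left h3 hD
    exact redmondOp_core hq (a := a) (b := b) (w := w) (s := s) (by nlinarith)
      (fun ρ hρ' => by nlinarith [hρ ρ hρ']) (fun ρ hρ' => by linarith [hρ ρ hρ']) hs

/-- **BCKV 2000, Lemma (second proof of Theorem 1)**, as printed: if the zeros of `q ≠ 0` lie in the
closed strip `|Re s| ≤ c` with `c > 0` and `a > 0`, then the zeros of
`r(s) = (s+a)q(s+2) − (s−a)q(s−2)` lie in the open strip `|Re s| < c`.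
[cite: BumpEtAl2000, §1, Lemma in the second proof of Thm. 1] -/
theorem bckv_stripLemma {q : ℂ[X]} (hq : q ≠ 0) {c a : ℝ} (hc : 0 < c) (ha : 0 < a)
    (hroots : ∀ ρ ∈ q.roots, |ρ.re| ≤ c) {s : ℂ}
    (hs : (redmondOp (a : ℂ) 2 1 q).eval s = 0) : |s.re| < c := by
  have h := redmondOp_eval_eq_zero_re (b := 2) (c := 1) (D := 1) (K := c) ha two_pos
    one_pos hq (by simpa using hroots) (s := s) (by simpa using hs)
  rcases h with h | h
  · simpa [h] using hc
  · simpa using h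

/-- **Olofsson 2009, Lemma 4.6** (the BCKV lemma with an arbitrary shift `b > 0`, Remark 4.7): zeros
of `q ≠ 0` in `|Re s| ≤ c` (`c > 0`), `a, b > 0` ⟹ zeros of `r(s) = (s+a)q(s+b) − (s−a)q(s−b)` in
`|Re s| < c`. [cite: Olofsson2009, Lemma 4.6, Remark 4.7] -/
theorem olofsson_lemma_4_6 {q : ℂ[X]} (hq : q ≠ 0) {c a b : ℝ} (hc : 0 < c) (ha : 0 < a)
    (hb : 0 < b) (hroots : ∀ ρ ∈ q.roots, |ρ.re| ≤ c) {s : ℂ}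
    (hs : (redmondOp (a : ℂ) (b : ℂ) 1 q).eval s = 0) : |s.re| < c := by
  have h := redmondOp_eval_eq_zero_re (c := 1) (D := 1) (K := c) ha hb
    one_pos hq (by simpa using hroots) (s := s) (by simpa using hs)
  rcases h with h | h
  · simpa [h] using hc
  · simpa using h

/-- `S(a,b,c)` (`a, b, c > 0`) annihilates no nonzero polynomial: a real point to the right of
`(K+1)/c` cannot be a zero of `S(a,b,c)q` by the strip lemma.
[cite: Redmond2002, eigenfunction observation] -/
theorem redmondOp_ne_zero {a b c : ℝ} (ha : 0 < a) (hb : 0 < b) (hc : 0 < c) {q : ℂ[X]}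
    (hq : q ≠ 0) : redmondOp (a : ℂ) (b : ℂ) (c : ℂ) q ≠ 0 := by
  set K : ℝ := (q.roots.map fun ρ => |ρ.re|).sum with hKdef
  have hKmem : ∀ ρ ∈ q.roots, 1 * |ρ.re| ≤ K := fun ρ hρ => by
    rw [one_mul]
    exact Multiset.single_le_sum (fun x hx => by
      obtain ⟨i, _, rfl⟩ := Multiset.mem_map.mp hx; exact abs_nonneg _) _
      (Multiset.mem_map_of_mem _ hρ)
  have hK : 0 ≤ K := Multiset.sum_nonneg fun x hx => by
    obtain ⟨i, _, rfl⟩ := Multiset.mem_map.mp hx; exact abs_nonneg _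
  intro h0
  set s : ℂ := (((K + 1) / c : ℝ) : ℂ) with hsdef
  have hsre : s.re = (K + 1) / c := by simp [hsdef]
  have hspos : 0 < s.re := by rw [hsre]; positivity
  have h := redmondOp_eval_eq_zero_re (c := c) (D := 1) (K := K) ha hb one_pos hq hKmem (s := s)
    (by rw [h0, eval_zero])
  rcases h with h | h
  · exact absurd h hspos.ne'
  · rw [abs_of_pos hspos, hsre, one_mul, mul_div_cancel₀ _ hc.ne'] at h
    linarith

/-- **Invariance of the class of polynomials with purely imaginary zeros** under one operator
`S(a,b,c)`, `a, b, c > 0` (the strip lemma with `K = 0`): if every root of `q` has `Re ρ = 0` then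
every root of `S(a,b,c)q` has `Re s = 0`.
[cite: Redmond2002, eigenfunction observation] [cite: HindmarshLettington2022, Thm. 1.1/1.2 (m < 0)] -/
theorem redmondOp_roots_re_eq_zero {a b c : ℝ} (ha : 0 < a) (hb : 0 < b) (hc : 0 < c) {q : ℂ[X]}
    (h : ∀ ρ ∈ q.roots, ρ.re = 0) :
    ∀ s ∈ (redmondOp (a : ℂ) (b : ℂ) (c : ℂ) q).roots, s.re = 0 := by
  intro s hs
  by_cases hq : q = 0
  · subst hq; simp at hs
  obtain ⟨-, hs⟩ := mem_roots'.mp hs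
  have h' := redmondOp_eval_eq_zero_re (c := c) (D := 1) (K := 0) ha hb one_pos hq
    (fun ρ hρ => by simp [h ρ hρ]) (s := s) hs
  rcases h' with h' | h'
  · exact h'
  · nlinarith [abs_nonneg s.re]

end StripLemma

section Eigenfunctions

/-- Iterating the strip lemma along a product: if `q ≠ 0` and every root `ρ` of `q` has `Re ρ = 0`
or `D·|Re ρ| < K` (`D > 0`, `K ≥ 0`), then `∏S(aᵢ,bᵢ,cᵢ) q ≠ 0` and every root `s` of it has
`Re s = 0` or `D·(∏cᵢ)·|Re s| < K`. [cite: Redmond2002, eigenfunction observation] -/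
theorem redmondProd_roots {l : List (ℝ × ℝ × ℝ)} (hl : ∀ p ∈ l, 0 < p.1 ∧ 0 < p.2.1 ∧ 0 < p.2.2)
    {K : ℝ} (hK : 0 ≤ K) :
    ∀ {D : ℝ}, 0 < D → ∀ {q : ℂ[X]}, q ≠ 0 → (∀ ρ ∈ q.roots, ρ.re = 0 ∨ D * |ρ.re| < K) →
      redmondProd l q ≠ 0 ∧
        ∀ s ∈ (redmondProd l q).roots, s.re = 0 ∨ D * (l.map (·.2.2)).prod * |s.re| < K := by
  induction l with
  | nil =>
    intro D _ q hq hρ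
    exact ⟨by simpa using hq, fun s hs => by simpa using hρ s hs⟩
  | cons p l ih =>
    intro D hD q hq hρ
    obtain ⟨ha, hb, hc⟩ := hl p (by simp)
    have hl' : ∀ p' ∈ l, 0 < p'.1 ∧ 0 < p'.2.1 ∧ 0 < p'.2.2 := fun p' hp' => hl p' (by simp [hp'])
    set q₁ := redmondOp (p.1 : ℂ) (p.2.1 : ℂ) (p.2.2 : ℂ) q with hq₁
    have hq₁0 : q₁ ≠ 0 := redmondOp_ne_zero ha hb hc hq
    have hρ' : ∀ ρ ∈ q.roots, D * |ρ.re| ≤ K := fun ρ hρ' => by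
      rcases hρ ρ hρ' with h | h
      · simpa [h] using hK
      · exact h.le
    have hρ₁ : ∀ ρ ∈ q₁.roots, ρ.re = 0 ∨ D * p.2.2 * |ρ.re| < K := fun ρ hρ₁ =>
      redmondOp_eval_eq_zero_re (c := p.2.2) (K := K) ha hb hD hq hρ' (mem_roots'.mp hρ₁).2
    obtain ⟨h1, h2⟩ := ih hl' (D := D * p.2.2) (by positivity) hq₁0 hρ₁
    refine ⟨by simpa [redmondProd_cons] using h1, fun s hs => ?_⟩
    rcases h2 s (by simpa [redmondProd_cons] using hs) with h | h
    · exact Or.inl h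
    · right
      simpa [List.map_cons, List.prod_cons, mul_assoc, mul_comm, mul_left_comm] using h

/-- **Redmond 2002** (statement as reported in the signed zbMATH review Zbl 1014.11051 of
[cite: Redmond2002, eigenfunction observation]): *any polynomial eigenfunction of a finite product
`∏ S(aᵢ,bᵢ,cᵢ)` (`aᵢ,bᵢ,cᵢ > 0`, `∏cᵢ ≥ 1`) must have all its zeros on the imaginary axis.* Here:
`l` a nonempty list of parameter triples, `q ≠ 0`, `∏S q = μ q` ⟹ `Re ρ = 0` for every root `ρ`
of `q`. (Proof: a root of maximal `|Re| = K > 0` would, by `redmondProd_roots`, force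
`(∏cᵢ)·K < K`.) -/
theorem redmond_eigenfunction_roots_re_eq_zero {l : List (ℝ × ℝ × ℝ)} (hl0 : l ≠ [])
    (hl : ∀ p ∈ l, 0 < p.1 ∧ 0 < p.2.1 ∧ 0 < p.2.2) (hlc : 1 ≤ (l.map (·.2.2)).prod)
    {q : ℂ[X]} (hq : q ≠ 0) {μ : ℂ} (he : redmondProd l q = μ • q) :
    ∀ ρ ∈ q.roots, ρ.re = 0 := by
  classical
  by_contra hcon
  push Not at hcon
  obtain ⟨ρ₀, hρ₀, hρ₀re⟩ := hcon
  obtain ⟨ρm, hρm, hmax⟩ := Finset.exists_max_image q.roots.toFinset (fun ρ => |ρ.re|)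
    ⟨ρ₀, Multiset.mem_toFinset.mpr hρ₀⟩
  set K : ℝ := |ρm.re| with hKdef
  have hK0 : 0 < K := lt_of_lt_of_le (abs_pos.mpr hρ₀re) (hmax ρ₀ (Multiset.mem_toFinset.mpr hρ₀))
  have hle : ∀ ρ ∈ q.roots, |ρ.re| ≤ K := fun ρ hρ => hmax ρ (Multiset.mem_toFinset.mpr hρ)
  obtain ⟨p, l', rfl⟩ := List.exists_cons_of_ne_nil hl0
  obtain ⟨ha, hb, hc⟩ := hl p (by simp)
  have hl' : ∀ p' ∈ l', 0 < p'.1 ∧ 0 < p'.2.1 ∧ 0 < p'.2.2 := fun p' hp' => hl p' (by simp [hp'])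
  set q₁ := redmondOp (p.1 : ℂ) (p.2.1 : ℂ) (p.2.2 : ℂ) q with hq₁
  have hq₁0 : q₁ ≠ 0 := redmondOp_ne_zero ha hb hc hq
  have hρ₁ : ∀ ρ ∈ q₁.roots, ρ.re = 0 ∨ p.2.2 * |ρ.re| < K := fun ρ hρ₁ => by
    have := redmondOp_eval_eq_zero_re (c := p.2.2) (D := 1) (K := K) ha hb one_pos hq
      (fun ρ hρ => by simpa using hle ρ hρ) (mem_roots'.mp hρ₁).2
    simpa using this
  obtain ⟨hT0, hT⟩ := redmondProd_roots hl' hK0.le hc hq₁0 hρ₁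
  have hT' : redmondProd l' q₁ = μ • q := by simpa [redmondProd_cons] using he
  have hμ : μ ≠ 0 := by
    rintro rfl
    exact hT0 (by simpa using hT')
  have hmem : ρm ∈ (redmondProd l' q₁).roots := by
    rw [hT', roots_smul_nonzero q hμ]; exact Multiset.mem_toFinset.mp hρm
  rcases hT ρm hmem with h | h
  · exact hK0.ne' (by simp [hKdef, h])
  · have hprod : (List.map (·.2.2) (p :: l')).prod = p.2.2 * (l'.map (·.2.2)).prod := by simp
    rw [hprod] at hlc
    nlinarith

/-- One operator: if `q ≠ 0` and `S(a,b,c) q = μ·q` with `a, b > 0`, `c ≥ 1`, then all zeros of `q`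
are purely imaginary. [cite: Redmond2002, eigenfunction observation] -/
theorem roots_re_eq_zero_of_redmondOp_eq_smul {a b c : ℝ} (ha : 0 < a) (hb : 0 < b) (hc : 1 ≤ c)
    {q : ℂ[X]} (hq : q ≠ 0) {μ : ℂ} (he : redmondOp (a : ℂ) (b : ℂ) (c : ℂ) q = μ • q) :
    ∀ ρ ∈ q.roots, ρ.re = 0 :=
  redmond_eigenfunction_roots_re_eq_zero (l := [(a, b, c)]) (by simp)
    (fun p hp => by simp only [List.mem_singleton] at hp; subst hp; exact ⟨ha, hb, by linarith⟩)
    (by simpa using hc) hq (μ := μ) (by simpa using he)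

/-- **BCKV 2000, second proof of Theorem 1** ("The theorem now follows from the Lemma"): if a
nonzero polynomial `q` satisfies `λ·q(s) = (s+a)q(s+2) − (s−a)q(s−2)` with `a > 0` (for the
Hermite–Mellin polynomials `q(s) = p_n(s+1/2)`: `a = 1/2` or `3/2`, the Mellin image of the
Schrödinger equation), then all zeros of `q` are purely imaginary, i.e. the zeros of `p_n` lie on
`Re s = 1/2`. [cite: BumpEtAl2000, §1, second proof of Thm. 1] -/
theorem bckv_roots_re_eq_zero_of_eigen {a : ℝ} (ha : 0 < a) {q : ℂ[X]} (hq : q ≠ 0) {μ : ℂ}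
    (he : redmondOp (a : ℂ) 2 1 q = μ • q) : ∀ ρ ∈ q.roots, ρ.re = 0 :=
  roots_re_eq_zero_of_redmondOp_eq_smul (b := 2) (c := 1) ha two_pos le_rfl hq (μ := μ)
    (by simpa using he)

/-- **Olofsson 2009, proof of Theorem 1.1** (local Riemann hypothesis for `ℂ` with `H = SU(2)`):
a nonzero polynomial `q` with `(m+1)·q(s) = (s + (k+1)/2)·q(s+1) − (s − (k+1)/2)·q(s−1)` has all
its zeros purely imaginary (there `q = q_m^{(k)} = p_m^{(k)}(· + 1/2)`, so the zeros of `p_m^{(k)}`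
lie on `Re s = 1/2`). [cite: Olofsson2009, proof of Thm. 1.1 via Lemma 4.5/4.6] -/
theorem olofsson_roots_re_eq_zero_of_eigen (m k : ℕ) {q : ℂ[X]} (hq : q ≠ 0)
    (he : redmondOp ((((k : ℝ) + 1) / 2 : ℝ) : ℂ) 1 1 q = ((m : ℂ) + 1) • q) :
    ∀ ρ ∈ q.roots, ρ.re = 0 :=
  roots_re_eq_zero_of_redmondOp_eq_smul (a := ((k : ℝ) + 1) / 2) (b := 1) (c := 1) (by positivity)
    one_pos le_rfl hq (μ := (m : ℂ) + 1) (by simpa using he)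

end Eigenfunctions

section HindmarshLettington

/-- **Hindmarsh–Lettington 2022, Theorems 1.1/1.2, case `m ≤ 0`** (any shift `b > 0`; `b = 1` is
Thm. 1.1, `b = 1/2` is Thm. 1.2): if all zeros of `P` lie on the imaginary axis then so do all zeros
of `Q(z) = (m−z)P(z+b) + (m+z)P(z−b)`. For `m < 0` this is `Q = −S(−m,b,1)P`; for `m = 0`,
`Q(z) = z·(P(z−b) − P(z+b))` and the strict product inequality applies. The printed cases `m ≥ ℓ`
(resp. `m ≥ ℓ + 1/2`) are NOT covered here. [cite: HindmarshLettington2022, Thm. 1.1/1.2 (m ≤ 0)] -/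
theorem hindmarshLettington_roots_re_eq_zero_of_nonpos {m b : ℝ} (hm : m ≤ 0) (hb : 0 < b)
    {P : ℂ[X]} (hP : ∀ ρ ∈ P.roots, ρ.re = 0) :
    ∀ s ∈ (hlTransform (m : ℂ) (b : ℂ) P).roots, s.re = 0 := by
  intro s hs
  rcases lt_or_eq_of_le hm with hm | rfl
  · have h := redmondOp_roots_re_eq_zero (a := -m) (b := b) (c := 1) (by linarith) hb one_pos hP
    rw [hlTransform_eq_neg_redmondOp, roots_neg] at hs
    exact h s (by simpa using hs)
  · obtain ⟨hQ0, hQs⟩ := mem_roots'.mp hs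
    have hev : (hlTransform ((0 : ℝ) : ℂ) (b : ℂ) P).eval s = s * (P.eval (s - b) - P.eval (s + b)) := by
      rw [eval_hlTransform]; push_cast; ring
    rw [IsRoot.def, hev, mul_eq_zero] at hQs
    rcases hQs with h0 | hdiff
    · simp [h0]
    · rw [sub_eq_zero] at hdiff
      by_contra hsre
      have hroots : P.roots ≠ 0 := by
        intro hP0
        apply hQ0
        have hPc : P = C P.leadingCoeff := by
          conv_lhs => rw [(IsAlgClosed.splits P).eq_prod_roots, hP0]
          simp
        rw [hPc, hlTransform]
        simp only [C_comp, Complex.ofReal_zero, map_zero, zero_sub, zero_add, neg_mul, neg_add_cancel]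
      rcases lt_or_gt_of_ne hsre with hneg | hpos
      · have h := norm_eval_sub_lt_norm_eval_add P s (b := -b) hroots
          (fun ρ hρ => by rw [hP ρ hρ]; nlinarith)
        push_cast at h
        rw [sub_neg_eq_add, ← sub_eq_add_neg, hdiff] at h
        exact lt_irrefl _ h
      · have h := norm_eval_sub_lt_norm_eval_add P s (b := b) hroots
          (fun ρ hρ => by rw [hP ρ hρ]; nlinarith)
        rw [hdiff] at h
        exact lt_irrefl _ h

/-- [cite: HindmarshLettington2022, Thm. 1.1 (case m ≤ 0)]: `Q₁(z) = (m−z)P(z+1) + (m+z)P(z−1)`. -/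
theorem hindmarshLettington_thm_1_1_nonpos {m : ℝ} (hm : m ≤ 0) {P : ℂ[X]}
    (hP : ∀ ρ ∈ P.roots, ρ.re = 0) : ∀ s ∈ (hlTransform (m : ℂ) 1 P).roots, s.re = 0 := by
  simpa using hindmarshLettington_roots_re_eq_zero_of_nonpos (b := 1) hm one_pos hP

/-- [cite: HindmarshLettington2022, Thm. 1.2 (case m ≤ 0)]: `Q₂(z) = (m−z)P(z+1/2) + (m+z)P(z−1/2)`. -/
theorem hindmarshLettington_thm_1_2_nonpos {m : ℝ} (hm : m ≤ 0) {P : ℂ[X]}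
    (hP : ∀ ρ ∈ P.roots, ρ.re = 0) : ∀ s ∈ (hlTransform (m : ℂ) (1 / 2) P).roots, s.re = 0 := by
  simpa using hindmarshLettington_roots_re_eq_zero_of_nonpos (b := 1 / 2) hm (by norm_num) hP

end HindmarshLettington

end LocalRH

end Literature.NumberTheory.LFunctions
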